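import Literature.AlgebraicGeometry.ShimuraVarieties.UnitaryShimuraCurveRecord
import Literature.NumberTheory.Automorphic.UnitaryGroupFormCongrFinSum
import HarnessLib

/-!
# The adapted frame `D′ = B·(g⋆ ⊕ 1)` of a split hermitian 3-space and the transport `U(H)(𝔸_f) → U(diag dV)(𝔸_f)`

For a CM field `L`, a hermitian `3 × 3` matrix `H` and a SPLITTING FRAME `B ∈ GL₃(L)` of the scaled form,
`ᵗ(cB)·(a H)·B = J⋆ ⊕ᶠ J⊥` (`J⋆` a `2 × 2` block, `J⊥` a `1 × 1` block — the datum of the embedded unitary Shimura curve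
`U(J⋆) ↪ U(H)`, `u ↦ B (u ⊕ 1) B⁻¹`, `UnitaryCanonicalModel.φGS`), together with a frame `g⋆ ∈ GL₂(L)` diagonalising the curve
block, `ᵗ(c g⋆)·(a⁻¹ J⋆)·g⋆ = diag dJ`, this file records:

* §1 **`gsAdaptedFrame B g⋆ := B · (g⋆ ⊕ 1)`** and **`gsAdaptedDiag := dJ ‖ (a⁻¹ · J⊥₀₀)`** with the adapted frame equation
  **`formCongr_gsAdaptedFrame : ᵗ(c D′)·((1:L) • H)·D′ = diag gsAdaptedDiag`**; reality and non-vanishing of the diagonal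
  (`gsAdaptedDiag_real`, `gsAdaptedDiag_ne`).
* §2 **`gsAdaptedTransport : U(H)(𝔸_{L,f}) →* U(diag dV)(𝔸_{L,f})`**, `k ↦ D′_f⁻¹ k D′_f` (`UnitaryGroup.finAdelicCongr` at the
  adapted frame, inverted) and **`coe_gsAdaptedTransport_φGS`**: `ι_{D′}(φGS u) = (g⋆_f⁻¹ u g⋆_f) ⊕ 1` in `GL₃(𝔸_{L,f})` — along the
  adapted frame the sub-datum `U(J⋆) ↪ U(H)` becomes the literal block diagonal of the transported curve element and `1`.
* §3 **`gsFrameComparison := D′⁻¹ · g₀`** for any other frame `g₀` of `H` (`ᵗ(c g₀) H g₀ = diag d₀`) and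
  **`formCongr_gsFrameComparison`**: it is an isometry `diag dV → diag d₀` on the nose.

This is the linear algebra behind the decomposition `V = V⋆ ⊕ V⋆^⊥` in the proof of [Liu2021, Thm. 4.15]
(FJcycle.tex l. 2193–2203: `G⋆ ↪ G` acting trivially on `V⋆^⊥`); transport of unitary groups along a change of frame is
[PlatonovRapinchuk1994, §2.3, §5.1].  The identification of `gsAdaptedTransport` with the Hodge–CM package's frame transport
`HodgeCM.Model.finFrameCongr` followed by `finAdelicCongr gsFrameComparison` is Summits-side
(`Summits/HodgeConjecture/HodgeCM/Model/GSAdaptedFrame.lean`), since `finFrameCongr` lives there.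

## References
* [Liu2021] Y. Liu, *Fourier–Jacobi cycles and arithmetic relative trace formula*, Camb. J. Math. 9 (2021) = arXiv:2102.11518,
  proof of Thm. 4.15 (FJcycle.tex l. 2193–2203), Def. 4.11 (l. 2092–2096).
* [PlatonovRapinchuk1994] V. Platonov, A. Rapinchuk, *Algebraic Groups and Number Theory* (1994), §2.3, §5.1.
-/

set_option autoImplicit false

noncomputable section

open scoped Matrix
open NumberField Matrix IsDedekindDomain
open Literature.NumberTheory.Automorphic Literature.NumberTheory.Automorphic.UnitaryGroup

namespace Literature.AlgebraicGeometry.ShimuraVarieties.UnitaryCanonicalModel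

/-! ## §1 The adapted frame of a split hermitian 3-space and its diagonal -/

section AdaptedFrame

variable (L : Type) [Field L] [NumberField L] [IsCMField L] (Jstar : Matrix (Fin 2) (Fin 2) L)
  (Jperp : Matrix (Fin 1) (Fin 1) L) (H : Matrix (Fin 3) (Fin 3) L) (B : GL (Fin 3) L) {a : L} (ha : a ≠ 0)
  (hB : formCongr ((IsCMField.complexConj L : L ≃ₐ[↥(maximalRealSubfield L)] L) : L →+* L) B (a • H) =
    finSum 2 1 Jstar Jperp)
  (gstar : GL (Fin 2) L) (dJ : Fin 2 → L)
  (hg : formCongr ((IsCMField.complexConj L : L ≃ₐ[↥(maximalRealSubfield L)] L) : L →+* L) gstar (a⁻¹ • Jstar) =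
    Matrix.diagonal dJ)

/-- **the ADAPTED FRAME `D′ := B · (g⋆ ⊕ 1)`** of a split hermitian 3-space: `B` splits `V = V⋆ ⊕ V⋆^⊥`, `g⋆` diagonalises
the `2`-dimensional block. [cite: Liu2021, proof of Thm. 4.15 (FJcycle.tex l. 2193–2203)] -/
def gsAdaptedFrame : GL (Fin 3) L :=
  B * UnitaryGroup.reindexGL finSumFinEquiv (blockDiagGL (gstar, (1 : GL (Fin 1) L)))

variable (a) in
/-- **the diagonal `dV := dJ ‖ a⁻¹·J⊥₀₀`** of `H` along the adapted frame. [cite: Liu2021, proof of Thm. 4.15 (FJcycle.tex l. 2193–2203)] -/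
def gsAdaptedDiag : Fin 3 → L :=
  Fin.append dJ ![a⁻¹ * Jperp 0 0]

omit [NumberField L] [IsCMField L] in
/-- `D′` as a matrix product (`rfl`). [cite: PlatonovRapinchuk1994, §2.3] -/
theorem gsAdaptedFrame_def :
    gsAdaptedFrame L B gstar = B * UnitaryGroup.reindexGL finSumFinEquiv (blockDiagGL (gstar, (1 : GL (Fin 1) L))) :=
  rfl

include ha hg in
/-- the curve frame at the unscaled block: `ᵗ(c g⋆)·J⋆·g⋆ = a · diag dJ`. [cite: PlatonovRapinchuk1994, §2.3] -/
theorem formCongr_gstar_eq_smul :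
    formCongr ((IsCMField.complexConj L : L ≃ₐ[↥(maximalRealSubfield L)] L) : L →+* L) gstar Jstar =
      a • Matrix.diagonal dJ := by
  rw [← hg, ← formCongr_smul_eq, smul_smul, mul_inv_cancel₀ ha, one_smul]

include ha hB hg in
/-- **the adapted frame equation at the scaled form**: `ᵗ(c D′)·(a H)·D′ = (a · diag dJ) ⊕ᶠ J⊥`.
[cite: Liu2021, proof of Thm. 4.15 (FJcycle.tex l. 2193–2203)] [cite: PlatonovRapinchuk1994, §2.3] -/
theorem formCongr_gsAdaptedFrame_smul :
    formCongr ((IsCMField.complexConj L : L ≃ₐ[↥(maximalRealSubfield L)] L) : L →+* L) (gsAdaptedFrame L B gstar) (a • H) =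
      finSum 2 1 (a • Matrix.diagonal dJ) Jperp := by
  rw [gsAdaptedFrame_def, formCongr_mul_eq, hB, formCongr_reindexGL_blockDiagGL_finSum,
    formCongr_gstar_eq_smul L Jstar ha gstar dJ hg]
  rw [formCongr_one_eq]

include ha hB hg in
/-- **the adapted frame equation**: `ᵗ(c D′)·((1:L) • H)·D′ = diag (dJ ‖ a⁻¹J⊥₀₀)` — the shape `UnitaryGroup.finAdelicCongr` (with
scalar `1`) and a REAL DIAGONAL `V`-form consume. [cite: Liu2021, proof of Thm. 4.15 (FJcycle.tex l. 2193–2203)]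
[cite: PlatonovRapinchuk1994, §2.3] -/
theorem formCongr_gsAdaptedFrame :
    formCongr ((IsCMField.complexConj L : L ≃ₐ[↥(maximalRealSubfield L)] L) : L →+* L) (gsAdaptedFrame L B gstar)
        ((1 : L) • H) = Matrix.diagonal (gsAdaptedDiag L Jperp a dJ) := by
  have h1 : (1 : L) • H = a⁻¹ • (a • H) := by rw [smul_smul, inv_mul_cancel₀ ha, one_smul]
  have h2 : a⁻¹ • Jperp = Matrix.diagonal ![(a⁻¹ • Jperp) 0 0] := by
    ext i j
    fin_cases i; fin_cases j
    simp
  rw [h1, formCongr_smul_eq, formCongr_gsAdaptedFrame_smul L Jstar Jperp H B ha hB gstar dJ hg, ← finSum_smul, smul_smul,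
    inv_mul_cancel₀ ha, one_smul, h2, finSum_diagonal]
  simp only [gsAdaptedDiag, Matrix.smul_apply, smul_eq_mul]

/-- the adapted diagonal is REAL when `dJ`, `a` and `J⊥₀₀` are. [cite: Liu2021, proof of Thm. 4.15 (FJcycle.tex l. 2193)] -/
theorem gsAdaptedDiag_real (hdJ : ∀ i, IsCMField.complexConj L (dJ i) = dJ i) (ha' : IsCMField.complexConj L a = a)
    (hJ : IsCMField.complexConj L (Jperp 0 0) = Jperp 0 0) :
    ∀ i, IsCMField.complexConj L (gsAdaptedDiag L Jperp a dJ i) = gsAdaptedDiag L Jperp a dJ i := by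
  intro i
  obtain ⟨x, rfl⟩ := (finSumFinEquiv : Fin 2 ⊕ Fin 1 ≃ Fin 3).surjective i
  rcases x with j | j
  · simp only [gsAdaptedDiag, finSumFinEquiv_apply_left, Fin.append_left, hdJ]
  · obtain rfl : j = 0 := Subsingleton.elim _ _
    simp only [gsAdaptedDiag, finSumFinEquiv_apply_right, Fin.append_right, Matrix.cons_val_zero, map_mul, map_inv₀, ha', hJ]

omit [NumberField L] [IsCMField L] in
include ha in
/-- the adapted diagonal is NON-DEGENERATE when `dJ` is and `a, J⊥₀₀ ≠ 0`. [cite: Liu2021, proof of Thm. 4.15 (FJcycle.tex l. 2193)] -/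
theorem gsAdaptedDiag_ne (hdJ0 : ∀ i, dJ i ≠ 0) (hJ0 : Jperp 0 0 ≠ 0) :
    ∀ i, gsAdaptedDiag L Jperp a dJ i ≠ 0 := by
  intro i
  obtain ⟨x, rfl⟩ := (finSumFinEquiv : Fin 2 ⊕ Fin 1 ≃ Fin 3).surjective i
  rcases x with j | j
  · simpa only [gsAdaptedDiag, finSumFinEquiv_apply_left, Fin.append_left] using hdJ0 j
  · obtain rfl : j = 0 := Subsingleton.elim _ _
    simpa only [gsAdaptedDiag, finSumFinEquiv_apply_right, Fin.append_right, Matrix.cons_val_zero] using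
      mul_ne_zero (inv_ne_zero ha) hJ0

/-! ## §2 The transport `U(H)(𝔸_f) → U(diag dV)(𝔸_f)` along `D′` and the junction with `φGS` -/

include ha hB hg in
/-- **`ι_{D′} : U(H)(𝔸_{L,f}) →* U(diag dV)(𝔸_{L,f})`, `k ↦ D′_f⁻¹ k D′_f`** (`UnitaryGroup.finAdelicCongr` at the adapted frame,
inverted). [cite: PlatonovRapinchuk1994, §2.3, §5.1] -/
def gsAdaptedTransport :
    ↥(finAdelic (↥(maximalRealSubfield L)) L (IsCMField.complexConj L) 3 H) →*
      ↥(finAdelic (↥(maximalRealSubfield L)) L (IsCMField.complexConj L) 3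
        (Matrix.diagonal (gsAdaptedDiag L Jperp a dJ))) :=
  (finAdelicCongr (↥(maximalRealSubfield L)) L (IsCMField.complexConj L) (gsAdaptedFrame L B gstar) one_ne_zero
      (formCongr_gsAdaptedFrame L Jstar Jperp H B ha hB gstar dJ hg)).symm.toMonoidHom

/-- `ι_{D′} k = D′_f⁻¹ k D′_f` in `GL₃(𝔸_{L,f})`. [cite: PlatonovRapinchuk1994, §2.3] -/
theorem coe_gsAdaptedTransport (k : ↥(finAdelic (↥(maximalRealSubfield L)) L (IsCMField.complexConj L) 3 H)) :
    ((gsAdaptedTransport L Jstar Jperp H B ha hB gstar dJ hg k :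
        ↥(finAdelic (↥(maximalRealSubfield L)) L (IsCMField.complexConj L) 3 (Matrix.diagonal (gsAdaptedDiag L Jperp a dJ)))) :
          GL (Fin 3) (FiniteAdeleRing (𝓞 L) L)) =
      (toFinAdeleGL L 3 (gsAdaptedFrame L B gstar))⁻¹ * k * toFinAdeleGL L 3 (gsAdaptedFrame L B gstar) :=
  rfl

/-- **THE ADAPTED FRAME SPLITS THE CURVE EMBEDDING**: `ι_{D′}(φGS u) = (g⋆_f⁻¹ u g⋆_f) ⊕ 1` in `GL₃(𝔸_{L,f})`, i.e. along `D′`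
the sub-datum `U(J⋆) ↪ U(H)`, `u ↦ B(u ⊕ 1)B⁻¹`, becomes the literal block diagonal of the transported curve element
`(finAdelicCongr g⋆ _ hg)⁻¹ u ∈ U(diag dJ)(𝔸_f)` and `1 ∈ U(a⁻¹J⊥)(𝔸_f)`. [cite: Liu2021, proof of Thm. 4.15 (FJcycle.tex l. 2193–2203)]
[cite: PlatonovRapinchuk1994, §2.3, §5.1] -/
theorem coe_gsAdaptedTransport_φGS (u : ↥(finAdelic (↥(maximalRealSubfield L)) L (IsCMField.complexConj L) 2 Jstar)) :
    ((gsAdaptedTransport L Jstar Jperp H B ha hB gstar dJ hg (φGS L Jstar Jperp H B ha hB u) :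
        ↥(finAdelic (↥(maximalRealSubfield L)) L (IsCMField.complexConj L) 3 (Matrix.diagonal (gsAdaptedDiag L Jperp a dJ)))) :
          GL (Fin 3) (FiniteAdeleRing (𝓞 L) L)) =
      UnitaryGroup.reindexGL finSumFinEquiv (blockDiagGL
        ((((finAdelicCongr (↥(maximalRealSubfield L)) L (IsCMField.complexConj L) gstar (inv_ne_zero ha) hg).symm u :
            ↥(finAdelic (↥(maximalRealSubfield L)) L (IsCMField.complexConj L) 2 (Matrix.diagonal dJ))) :
              GL (Fin 2) (FiniteAdeleRing (𝓞 L) L)),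
          (1 : GL (Fin 1) (FiniteAdeleRing (𝓞 L) L)))) := by
  rw [coe_gsAdaptedTransport, φGS_apply, coe_finAdelicCongr_apply, coe_finAdelicBlockDiag, coe_finAdelicCongr_symm_apply,
    gsAdaptedFrame_def, map_mul, UnitaryGroup.map_reindexGL, map_blockDiagGL]
  dsimp only
  rw [map_one, OneMemClass.coe_one,
    show ∀ Bf Rf X : GL (Fin 3) (FiniteAdeleRing (𝓞 L) L), (Bf * Rf)⁻¹ * (Bf * X * Bf⁻¹) * (Bf * Rf) = Rf⁻¹ * X * Rf from
      fun Bf Rf X => by group]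
  simp only [← map_inv, ← map_mul, Prod.inv_mk, Prod.mk_mul_mk, inv_one, mul_one]

end AdaptedFrame

/-! ## §3 The comparison isometry `D′⁻¹ · g₀` with any other frame `g₀` of `H` -/

section Comparison

variable (L : Type) [Field L] [NumberField L] [IsCMField L] (Jstar : Matrix (Fin 2) (Fin 2) L)
  (Jperp : Matrix (Fin 1) (Fin 1) L) (H : Matrix (Fin 3) (Fin 3) L) (B : GL (Fin 3) L) {a : L} (ha : a ≠ 0)
  (hB : formCongr ((IsCMField.complexConj L : L ≃ₐ[↥(maximalRealSubfield L)] L) : L →+* L) B (a • H) =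
    finSum 2 1 Jstar Jperp)
  (gstar : GL (Fin 2) L) (dJ : Fin 2 → L)
  (hg : formCongr ((IsCMField.complexConj L : L ≃ₐ[↥(maximalRealSubfield L)] L) : L →+* L) gstar (a⁻¹ • Jstar) =
    Matrix.diagonal dJ)
  (g₀ : GL (Fin 3) L) (d₀ : Fin 3 → L)
  (hg₀ : ((g₀ : Matrix (Fin 3) (Fin 3) L).map (cmConjRingHom L))ᵀ * H * (g₀ : Matrix (Fin 3) (Fin 3) L) = Matrix.diagonal d₀)

/-- **the comparison isometry `D′⁻¹ · g₀`** from a frame `g₀` of `H` (`ᵗ(c g₀) H g₀ = diag d₀`) to the adapted frame `D′`.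
[cite: PlatonovRapinchuk1994, §2.3] -/
def gsFrameComparison : GL (Fin 3) L :=
  (gsAdaptedFrame L B gstar)⁻¹ * g₀

/-- the two spellings of complex conjugation on matrices over a CM field agree (`cmConjRingHom` vs the `AlgEquiv` coercion of
`IsCMField.complexConj`). [cite: PlatonovRapinchuk1994, §2.3] -/
theorem map_cmConjRingHom_eq {m n : Type*} (M : Matrix m n L) :
    M.map (cmConjRingHom L) = M.map ((IsCMField.complexConj L : L ≃ₐ[↥(maximalRealSubfield L)] L) : L →+* L) :=
  Matrix.ext fun _ _ => rfl

include ha hB hg hg₀ in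
/-- **`D′⁻¹ · g₀` is an ISOMETRY `diag dV → diag d₀` on the nose** (scalar `1`):
`ᵗ(c (D′⁻¹g₀))·((1:L) • diag (dJ ‖ a⁻¹J⊥₀₀))·(D′⁻¹g₀) = diag d₀`. [cite: PlatonovRapinchuk1994, §2.3]
[cite: Liu2021, Def. 4.11 (l. 2092–2096)] -/
theorem formCongr_gsFrameComparison :
    formCongr ((IsCMField.complexConj L : L ≃ₐ[↥(maximalRealSubfield L)] L) : L →+* L) (gsFrameComparison L B gstar g₀)
        ((1 : L) • Matrix.diagonal (gsAdaptedDiag L Jperp a dJ)) = Matrix.diagonal d₀ := by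
  rw [gsFrameComparison, formCongr_mul_eq, ← formCongr_gsAdaptedFrame L Jstar Jperp H B ha hB gstar dJ hg, ← formCongr_smul_eq,
    formCongr_inv_formCongr, one_smul, one_smul, ← hg₀, map_cmConjRingHom_eq]

end Comparison

end Literature.AlgebraicGeometry.ShimuraVarieties.UnitaryCanonicalModel

end
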